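import Mathlib.Analysis.SpecialFunctions.SmoothTransition
import Mathlib.Analysis.InnerProductSpace.Calculus
import Mathlib.Geometry.Manifold.MFDeriv.FDeriv
import Mathlib.Geometry.Manifold.MFDeriv.SpecificFunctions
import Mathlib.Geometry.Manifold.ContMDiffMFDeriv
import Literature.Topology.FourManifolds.SliceGenus
import Literature.Topology.FourManifolds.Cobordism
import Literature.Topology.FourManifolds.BoundaryFlowout
import Literature.Topology.FourManifolds.ChartDerivative
import Literature.Topology.FourManifolds.RegularSlabField
import HarnessLib

/-!
# Straightening a neat slice surface near its boundary (the neat case of fact A)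

Trunk T-4MAN (`Literature/Topology/FourManifolds`).  Towards the named fact
`Literature.Topology.FourManifolds.Knot.HasSliceSurfaceOfGenus.exists_radial` (fact A of `SliceGenusConcordance.lean`: a
slice surface can be replaced by one which is radial near its boundary; with facts B and C
proved, it is all that the concordance invariance of the slice genus,
`Literature.Topology.FourManifolds.Knot.IsConcordant.sliceGenus_eq`, Livingston 2005, §9.5, still rests on), this file proves
the **neat case**:

* `Literature.Knot.HasNeatSliceSurfaceOfGenus K g` (definition): the data of
  `HasSliceSurfaceOfGenus K g` together with *neatness* — `1` is a regular value of `‖F‖²` at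
  every boundary point (`d(‖F‖²)_p ≠ 0` on `∂S`), i.e. the surface `F(S) ⊂ B⁴` meets
  `𝕊 3 = ∂B⁴` transversally along `∂S` (Kosinski 1993, II (2.2), IV §1: neat submanifolds).
* `Literature.Topology.FourManifolds.Knot.HasNeatSliceSurfaceOfGenus.exists_radial` (**proved**): a neat slice surface of genus
  `g` for `K` yields, on the *same* abstract surface `S` with the same boundary identification
  `e`, a slice surface of genus `g` which is radial near its boundary — the conclusion is the
  body of `Literature.Knot.HasRadialSliceSurfaceOfGenus K g` spelled out (that definition lives in
  `SliceGenusConcordance.lean`; the one-line repackaging is left to the sibling proof file).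

What remains of fact A after this file is the normalisation "every slice surface can be replaced
by a *neat* one of the same genus" (general position of the surface with respect to `∂B⁴` along
its boundary), which is not treated here.

## Proof

Let `F : S → B⁴` be neat, `f = 1 - ‖F‖²` (the *defect*).  Then `f ≥ 0`, `f = 0` exactly on `∂S`,
and `df ≠ 0` on `∂S` by neatness: `f` is a boundary-defining function, and the tree's flow-out
collar machinery applies to it verbatim (the pattern of `Literature.Topology.FourManifolds.nonempty_flowoutInput`,
`CollarTheorem.lean`): `Literature.Topology.FourManifolds.exists_pos_forall_mfderiv_ne_zero` (`ChartDerivative.lean`) and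
`Literature.Topology.FourManifolds.exists_contMDiffSection_mlineDeriv_eq_one_on` (`RegularSlabField.lean`) give a
`Literature.Topology.FourManifolds.FlowoutInput` with this `f`, `FlowoutInput.nonempty_cover` a cover `Γ`, and
`FlowoutInput.Cover.openCollarData` (`BoundaryFlowout.lean`, Milnor 1965, proof of Thm. 3.4) an
open collar `toFun : ∂S × [0, 2) → S` of the boundary datum `∂S`
(`Literature.Topology.FourManifolds.BoundaryManifold.boundaryData`, `Cobordism.lean`) whose height function is `(2/a) f`:
**the collar is parametrised by the level of `‖F‖`**, `‖F (toFun x t)‖² = 1 - t a / 2`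
(`NeatData.norm_sq_toFun`).  With the collar time `t = (2/a) f` and the freezing time
`c₂ t = t S(2t - 1)` (`0` for `t ≤ 1/2`, `t` for `t ≥ 1`), the **frozen map** is

  `newMap z = (‖F z‖ / ‖F (Λ z)‖) • F (Λ z)`, `Λ z = toFun (proj z) (c₂ (t z))`, on `{t < 3/2}`,

and `F z` elsewhere (`NeatData.newMap`; the two agree on `{1 ≤ t < 3/2}`).  It is `F` for
`t ≥ 1`, the cone `‖F z‖ • K (e (proj z))` for `t ≤ 1/2` (`newMap_of_le_half`), preserves the
level `‖newMap z‖ = ‖F z‖` (`norm_newMap`), is smooth (`contMDiff_newMap`), injective (levels,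
then the level circles, `injective_newMap`), equal to `K ∘ e` on `∂S` (`newMap_coe`), sends the
interior into the open ball, and is radial on the band `{‖·‖ > 1 - a/8} ⊂ {t < 1/2}` with angular
map `e ∘ proj`, smooth because `e` is (`contMDiff_e`: `K ∘ e = F|∂S` with `K` an immersion,
`ContMDiff.iff_comp_isImmersion`).  The immersion property (`injective_mfderiv_newMap`): on the
zone, `‖newMap‖² = 1 - (a/2) t`, so `D(newMap) w = 0` forces `Dt w = 0`
(`mfderiv_tfun_eq_zero`); then `w = DT (Dproj w, 0)` is tangent to the level circle
(`apply_prod_apply_eq`: `T ∘ P = id` on the region, `P = (proj, t)`), along which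
`newMap = m • F ∘ circ (c₂ t₀)`, `m ≠ 0`, an immersion because `F` is one and
`D(circ) = DT ∘ inl` with `DT` injective (`P ∘ T = id` on `∂S × [0, 2)`, unique derivatives
there).

## References

* A. A. Kosinski, *Differential Manifolds* (1993), II (2.2) (neat submanifolds), II (2.8.2)
  (a neat submanifold meets a suitable collar of the boundary in a collar), IV §1 (neat =
  transversal to the boundary). [Kosinski1993]
* J. Milnor, *Lectures on the h-cobordism theorem* (1965), proof of Thm. 3.4 (the collar as a
  flow-out along a boundary-defining function). [MilnorHCobordism1965]
* C. Livingston, *A survey of classical knot concordance* (2005), §9.5. [Livingston2005]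
* Tree: `Literature.Topology.FourManifolds.Knot.HasSliceSurfaceOfGenus`, `IsSpanningSurfaceOfGenus` (`SliceGenus.lean`);
  `Literature.Topology.FourManifolds.FlowoutInput`, `FlowoutInput.Cover.openCollarData` (`BoundaryFlowout.lean`);
  `Literature.Topology.FourManifolds.BoundaryData.OpenCollarData` (`CollarCriterion.lean`); `Literature.Topology.FourManifolds.BoundaryManifold.boundaryData`
  (`Cobordism.lean`); `Literature.Topology.FourManifolds.exists_pos_forall_mfderiv_ne_zero` (`ChartDerivative.lean`);
  `Literature.Topology.FourManifolds.exists_contMDiffSection_mlineDeriv_eq_one_on` (`RegularSlabField.lean`).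
-/

open scoped Manifold ContDiff Topology
open Function Set

noncomputable section

namespace Literature.Topology.FourManifolds

/-- Local notation: `𝔼 n` is the model Euclidean space `EuclideanSpace ℝ (Fin n)`. -/
local notation "𝔼 " n:arg => EuclideanSpace ℝ (Fin n)

/-- Local notation: `𝕊 n` is the unit sphere in `EuclideanSpace ℝ (Fin (n + 1))`. -/
local notation "𝕊 " n:arg => (Metric.sphere (0 : EuclideanSpace ℝ (Fin (n + 1))) 1)

namespace Knot

/-! ## Neat slice surfaces -/

/-- `K` **bounds a neat slice surface of genus `g`**: the data of `HasSliceSurfaceOfGenus K g`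
(a compact connected orientable surface `S` with one boundary circle and a smooth injective
immersion `F : S → B⁴` with `F = K ∘ e` on `∂S` and `F (int S) ⊂ int B⁴`) which moreover meets
`𝕊 3 = ∂B⁴` transversally along `∂S`: `1` is a regular value of `‖F‖²` at every boundary point,
`d(‖F‖²)_p ≠ 0` for `p ∈ ∂S`.  This is neatness of the submanifold `F(S) ⊂ B⁴` (Kosinski 1993,
II (2.2) and IV §1, p. 62: a submanifold with `M ∩ ∂N = ∂M` is neat iff it is transversal to
`∂N`; Hirsch 1976, Ch. 1 §4). [cite: Kosinski1993, II (2.2)] -/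
def HasNeatSliceSurfaceOfGenus (K : Knot) (g : ℕ) : Prop :=
  ∃ (S : Type) (_ : TopologicalSpace S) (_ : T2Space S) (_ : SecondCountableTopology S)
    (_ : CompactSpace S) (_ : ConnectedSpace S) (_ : ChartedSpace (EuclideanHalfSpace 2) S)
    (_ : IsManifold (𝓡∂ 2) ∞ S) (F : S → 𝔼 4) (e : ↥((𝓡∂ 2).boundary S) ≃ₜ ↥(𝕊 1)),
    K.IsSpanningSurfaceOfGenus F e g ∧ (∀ x ∈ (𝓡∂ 2).interior S, ‖F x‖ < 1) ∧
    ∀ p ∈ (𝓡∂ 2).boundary S, mfderiv (𝓡∂ 2) 𝓘(ℝ, ℝ) (fun q ↦ ‖F q‖ ^ 2) p ≠ 0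

/-- A neat slice surface is in particular a slice surface. [folklore] -/
theorem HasNeatSliceSurfaceOfGenus.hasSliceSurfaceOfGenus {K : Knot} {g : ℕ}
    (h : K.HasNeatSliceSurfaceOfGenus g) : K.HasSliceSurfaceOfGenus g := by
  obtain ⟨S, i₁, i₂, i₃, i₄, i₅, i₆, i₇, F, e, hF, hint, -⟩ := h
  exact ⟨S, i₁, i₂, i₃, i₄, i₅, i₆, i₇, F, e, hF, hint⟩

/-! ## The level-preserving collar of a neat slice surface -/

namespace NeatStraightening

section Setup

variable {S : Type} [TopologicalSpace S] [T2Space S] [CompactSpace S]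
  [ChartedSpace (EuclideanHalfSpace 2) S] [IsManifold (𝓡∂ 2) ∞ S]
  {K : Knot} {F : S → 𝔼 4} {e : ↥((𝓡∂ 2).boundary S) ≃ₜ ↥(𝕊 1)}

/-- The **defect** `f = 1 - ‖F‖²` of a slice surface: a boundary-defining function when `F` is
neat. [folklore] -/
def defect (F : S → 𝔼 4) (z : S) : ℝ :=
  1 - ‖F z‖ ^ 2

omit [T2Space S] [CompactSpace S] [IsManifold (𝓡∂ 2) ∞ S] in
/-- The defect is `C^∞`. [folklore] -/
theorem contMDiff_defect (hFs : ContMDiff (𝓡∂ 2) 𝓘(ℝ, 𝔼 4) ∞ F) :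
    ContMDiff (𝓡∂ 2) 𝓘(ℝ, ℝ) ∞ (defect F) :=
  (contDiff_const.sub (contDiff_norm_sq ℝ)).comp_contMDiff hFs

omit [T2Space S] [CompactSpace S] [IsManifold (𝓡∂ 2) ∞ S] in
/-- `‖F‖ ≤ 1` on a slice surface. [folklore] -/
theorem norm_le_one (hFb : ∀ x : ↥((𝓡∂ 2).boundary S), F x = ((K (e x) : 𝕊 3) : 𝔼 4))
    (hint : ∀ x ∈ (𝓡∂ 2).interior S, ‖F x‖ < 1) (z : S) : ‖F z‖ ≤ 1 := by
  by_cases hz : z ∈ (𝓡∂ 2).interior S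
  · exact (hint z hz).le
  · have hb : z ∈ (𝓡∂ 2).boundary S := by
      rw [← ModelWithCorners.compl_interior]; exact hz
    rw [show F z = ((K (e ⟨z, hb⟩) : 𝕊 3) : 𝔼 4) from hFb ⟨z, hb⟩, norm_eq_of_mem_sphere]

omit [T2Space S] [CompactSpace S] [IsManifold (𝓡∂ 2) ∞ S] in
/-- `‖F z‖ = 1` iff `z ∈ ∂S`. [folklore] -/
theorem norm_eq_one_iff (hFb : ∀ x : ↥((𝓡∂ 2).boundary S), F x = ((K (e x) : 𝕊 3) : 𝔼 4))
    (hint : ∀ x ∈ (𝓡∂ 2).interior S, ‖F x‖ < 1) (z : S) :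
    ‖F z‖ = 1 ↔ z ∈ (𝓡∂ 2).boundary S := by
  constructor
  · intro h
    rw [← ModelWithCorners.compl_interior]
    intro hz
    exact (hint z hz).ne h
  · intro hz
    rw [show F z = ((K (e ⟨z, hz⟩) : 𝕊 3) : 𝔼 4) from hFb ⟨z, hz⟩, norm_eq_of_mem_sphere]

/-- **Flow-out input from a neat slice surface**: the defect `1 - ‖F‖²` is a boundary-defining
function, regular near `∂S` by neatness (`Literature.Topology.FourManifolds.exists_pos_forall_mfderiv_ne_zero`), and
`Literature.Topology.FourManifolds.exists_contMDiffSection_mlineDeriv_eq_one_on` provides the field `ξ` with `ξ(f) = 1` near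
`∂S` (the pattern of `Literature.Topology.FourManifolds.nonempty_flowoutInput`, `CollarTheorem.lean`).
[cite: MilnorHCobordism1965, proof of Thm. 3.4] -/
theorem exists_flowoutInput (hFs : ContMDiff (𝓡∂ 2) 𝓘(ℝ, 𝔼 4) ∞ F)
    (hFb : ∀ x : ↥((𝓡∂ 2).boundary S), F x = ((K (e x) : 𝕊 3) : 𝔼 4))
    (hint : ∀ x ∈ (𝓡∂ 2).interior S, ‖F x‖ < 1)
    (hneat : ∀ p ∈ (𝓡∂ 2).boundary S, mfderiv (𝓡∂ 2) 𝓘(ℝ, ℝ) (fun q ↦ ‖F q‖ ^ 2) p ≠ 0) :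
    ∃ D : FlowoutInput 1 S, D.f = defect F := by
  classical
  set f : S → ℝ := defect F with hf
  have hfs : ContMDiff (𝓡∂ 2) 𝓘(ℝ, ℝ) ∞ f := contMDiff_defect hFs
  have hf0 : ∀ z, 0 ≤ f z := by
    intro z
    have h := norm_le_one hFb hint z
    simp only [hf, defect]
    nlinarith [norm_nonneg (F z)]
  have hfb : ∀ z, f z = 0 ↔ z ∈ (𝓡∂ 2).boundary S := by
    intro z
    rw [← norm_eq_one_iff hFb hint z]
    simp only [hf, defect]
    constructor
    · intro h
      have h1 : ‖F z‖ ^ 2 = 1 := by linarith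
      have h2 : 0 ≤ ‖F z‖ := norm_nonneg _
      nlinarith
    · intro h
      rw [h]
      norm_num
  have hreg : ∀ z, f z = 0 → mfderiv (𝓡∂ 2) 𝓘(ℝ, ℝ) f z ≠ 0 := by
    intro z hz hcrit
    have hzb := (hfb z).1 hz
    have hgs : ContMDiff (𝓡∂ 2) 𝓘(ℝ, ℝ) ∞ fun q ↦ ‖F q‖ ^ 2 :=
      (contDiff_norm_sq ℝ).comp_contMDiff hFs
    have hfz : HasMFDerivAt (𝓡∂ 2) 𝓘(ℝ, ℝ) f z 0 :=
      hcrit ▸ (hfs.mdifferentiableAt (by simp)).hasMFDerivAt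
    have h1 := (hasMFDerivAt_const (I := 𝓡∂ 2) (I' := 𝓘(ℝ, ℝ)) (1 : ℝ) z).sub hfz
    have heq : ((fun _ : S => (1 : ℝ)) - f) = fun q ↦ ‖F q‖ ^ 2 := by
      funext q
      simp [hf, defect]
    rw [heq] at h1
    have h2 : mfderiv (𝓡∂ 2) 𝓘(ℝ, ℝ) (fun q ↦ ‖F q‖ ^ 2) z = 0 := by
      rw [h1.mfderiv]; exact sub_self _
    exact hneat z hzb h2
  obtain ⟨δ', hδ', hδ'reg⟩ := exists_pos_forall_mfderiv_ne_zero hfs hf0 hreg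
  set δ := δ' / 2 with hδ
  have hδpos : 0 < δ := by positivity
  have hreg2 : ∀ z ∈ {z : S | f z ≤ δ}, mfderiv (𝓡∂ 2) 𝓘(ℝ, ℝ) f z ≠ 0 := fun z hz =>
    hδ'reg z (by simp only [mem_setOf_eq] at hz; linarith)
  obtain ⟨ξ, hξ⟩ := exists_contMDiffSection_mlineDeriv_eq_one_on hfs
    (isClosed_le hfs.continuous continuous_const) hreg2
  exact ⟨⟨f, ξ, δ, hδpos, hfs, hf0, hfb, ξ.contMDiff, fun z hz => hξ z hz⟩, rfl⟩

/-- The boundary datum of the surface: the subtype `∂S` with its manifold structure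
(`Literature.Topology.FourManifolds.BoundaryManifold.boundaryData`). [folklore] -/
abbrev bdry (S : Type) [TopologicalSpace S] [ChartedSpace (EuclideanHalfSpace 2) S]
    [IsManifold (𝓡∂ 2) ∞ S] : BoundaryData (𝓡∂ 2) S (𝓡 1) :=
  BoundaryManifold.boundaryData 1 S

/-- **The level-preserving open collar of a neat slice surface.** There are a flow-out input
`D` with `D.f = 1 - ‖F‖²`, a cover `Γ`, and the open collar data `O = Γ.openCollarData` of the
boundary datum `∂S` (`BoundaryFlowout.lean`), so that `O.height = (2 / Γ.a) • (1 - ‖F‖²)`: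
the collar lines are parametrised by the level of `‖F‖`. [cite: MilnorHCobordism1965, proof of Thm. 3.4] -/
theorem exists_cover (hFs : ContMDiff (𝓡∂ 2) 𝓘(ℝ, 𝔼 4) ∞ F)
    (hFb : ∀ x : ↥((𝓡∂ 2).boundary S), F x = ((K (e x) : 𝕊 3) : 𝔼 4))
    (hint : ∀ x ∈ (𝓡∂ 2).interior S, ‖F x‖ < 1)
    (hneat : ∀ p ∈ (𝓡∂ 2).boundary S, mfderiv (𝓡∂ 2) 𝓘(ℝ, ℝ) (fun q ↦ ‖F q‖ ^ 2) p ≠ 0) :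
    ∃ (D : FlowoutInput 1 S) (_ : D.Cover), D.f = defect F := by
  obtain ⟨D, hD⟩ := exists_flowoutInput hFs hFb hint hneat
  obtain ⟨Γ⟩ := D.nonempty_cover
  exact ⟨D, Γ, hD⟩

end Setup

/-! ## The data of the straightening and the frozen map -/

/-- **The data of the straightening of a neat slice surface**: the surface map `F` with its
boundary identification `e`, smooth, injective, immersive, `F = K ∘ e` on `∂S`, interior inside
`B⁴`, together with a flow-out input `D` whose boundary-defining function is the defect
`1 - ‖F‖²` and a cover `Γ` (so that `Γ.openCollarData` is a collar parametrised by the level of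
`‖F‖`). [folklore] -/
structure NeatData (S : Type) [TopologicalSpace S] [ChartedSpace (EuclideanHalfSpace 2) S]
    [IsManifold (𝓡∂ 2) ∞ S] (K : Knot) where
  /-- the surface map -/
  F : S → 𝔼 4
  /-- the boundary identification -/
  e : ↥((𝓡∂ 2).boundary S) ≃ₜ ↥(𝕊 1)
  smooth : ContMDiff (𝓡∂ 2) 𝓘(ℝ, 𝔼 4) ∞ F
  inj : Injective F
  imm : ∀ x, Injective (mfderiv (𝓡∂ 2) 𝓘(ℝ, 𝔼 4) F x)
  bdryEq : ∀ x : ↥((𝓡∂ 2).boundary S), F x = ((K (e x) : 𝕊 3) : 𝔼 4)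
  interior_lt : ∀ x ∈ (𝓡∂ 2).interior S, ‖F x‖ < 1
  /-- the flow-out input with `D.f = 1 - ‖F‖²` -/
  D : FlowoutInput 1 S
  /-- the cover -/
  Γ : D.Cover
  f_eq : D.f = defect F

namespace NeatData

variable {S : Type} [TopologicalSpace S] [ChartedSpace (EuclideanHalfSpace 2) S]
  [IsManifold (𝓡∂ 2) ∞ S] {K : Knot} (d : NeatData S K)

/-- The height `a` of the cover is positive. [folklore] -/
theorem a_pos : 0 < d.Γ.a := d.Γ.a_pos

/-- `f = 1 - ‖F‖²`. [folklore] -/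
theorem f_apply (z : S) : d.D.f z = 1 - ‖d.F z‖ ^ 2 := by
  rw [d.f_eq]
  rfl

/-- `‖F z‖² = 1 - f z`. [folklore] -/
theorem norm_sq_eq (z : S) : ‖d.F z‖ ^ 2 = 1 - d.D.f z := by
  rw [d.f_apply]
  ring

/-- The **collar time** `t z = (2/a) f z` (the height function of the collar, globally smooth). [folklore] -/
def tfun (z : S) : ℝ :=
  d.D.f z * (2 / d.Γ.a)

/-- `f = (a/2) t`. [folklore] -/
theorem f_eq_tfun (z : S) : d.D.f z = d.tfun z * (d.Γ.a / 2) := by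
  unfold tfun
  have ha := d.a_pos.ne'
  field_simp

/-- `t` is `C^∞`. [folklore] -/
theorem contMDiff_tfun : ContMDiff (𝓡∂ 2) 𝓘(ℝ, ℝ) ∞ d.tfun :=
  (contDiff_id.mul contDiff_const).comp_contMDiff d.D.f_smooth

/-- `t` is continuous. [folklore] -/
theorem continuous_tfun : Continuous d.tfun := d.contMDiff_tfun.continuous

/-- `0 ≤ t`. [folklore] -/
theorem tfun_nonneg (z : S) : 0 ≤ d.tfun z :=
  mul_nonneg (d.D.f_nonneg z) (div_nonneg zero_le_two d.a_pos.le)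

/-- `t z = 0` iff `z ∈ ∂S`. [folklore] -/
theorem tfun_eq_zero_iff (z : S) : d.tfun z = 0 ↔ z ∈ (𝓡∂ 2).boundary S := by
  rw [← d.D.f_eq_zero_iff z]
  unfold tfun
  constructor
  · intro h
    rcases mul_eq_zero.1 h with h | h
    · exact h
    · exfalso
      have := d.a_pos
      rw [div_eq_zero_iff] at h
      rcases h with h | h <;> linarith
  · intro h
    rw [h, zero_mul]

/-! ### The freezing time -/

/-- The **freezing time** `c₂ t = t S(2t - 1)`: `0` for `t ≤ 1/2`, `t` for `t ≥ 1`, in `[0, t]`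
for `t ≥ 0`. [folklore] -/
def frz (t : ℝ) : ℝ :=
  t * Real.smoothTransition (2 * t - 1)

/-- `c₂` is `C^∞`. [folklore] -/
theorem contDiff_frz : ContDiff ℝ ∞ frz :=
  contDiff_id.mul (Real.smoothTransition.contDiff.comp
    ((contDiff_const.mul contDiff_id).sub contDiff_const))

/-- `c₂ t = 0` for `t ≤ 1/2`. [folklore] -/
theorem frz_of_le {t : ℝ} (ht : t ≤ 1 / 2) : frz t = 0 := by
  unfold frz
  rw [Real.smoothTransition.zero_of_nonpos (by linarith), mul_zero]

/-- `c₂ t = t` for `t ≥ 1`. [folklore] -/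
theorem frz_of_ge {t : ℝ} (ht : 1 ≤ t) : frz t = t := by
  unfold frz
  rw [Real.smoothTransition.one_of_one_le (by linarith), mul_one]

/-- `0 ≤ c₂ t` for `t ≥ 0`. [folklore] -/
theorem frz_nonneg {t : ℝ} (ht : 0 ≤ t) : 0 ≤ frz t :=
  mul_nonneg ht (Real.smoothTransition.nonneg _)

/-- `c₂ t ≤ t` for `t ≥ 0`. [folklore] -/
theorem frz_le {t : ℝ} (ht : 0 ≤ t) : frz t ≤ t := by
  unfold frz
  nlinarith [Real.smoothTransition.le_one (2 * t - 1)]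

variable [T2Space S] [Nonempty (bdry S).carrier]

/-- The level-preserving open collar `O = Γ.openCollarData ∂S`. [folklore] -/
def O : (bdry S).OpenCollarData :=
  d.Γ.openCollarData (bdry S)

/-- The top of the collar is `2` (definitional). [folklore] -/
theorem O_top : d.O.top = 2 := rfl

/-- The height function of the collar is `(2/a) f` (definitional). [folklore] -/
theorem O_height (z : S) : d.O.height z = d.D.f z * (2 / d.Γ.a) := rfl

/-- `t = height`. [folklore] -/
theorem tfun_eq_height (z : S) : d.tfun z = d.O.height z := rfl

/-- The region of the collar is `{f < a}` (definitional). [folklore] -/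
theorem mem_region_iff (z : S) : z ∈ d.O.region ↔ d.D.f z < d.Γ.a := Iff.rfl

/-- **The collar is level preserving**: `f (toFun x t) = t a / 2`. [folklore] -/
theorem f_toFun (x : (bdry S).carrier) {t : ℝ} (ht : t ∈ Ico (0 : ℝ) 2) :
    d.D.f (d.O.toFun x t) = t * (d.Γ.a / 2) := by
  have h := d.O.height_apply x t ht
  rw [O_height] at h
  have ha := d.a_pos.ne'
  field_simp at h
  linarith

/-- `‖F (toFun x t)‖² = 1 - t a / 2`. [folklore] -/
theorem norm_sq_toFun (x : (bdry S).carrier) {t : ℝ} (ht : t ∈ Ico (0 : ℝ) 2) :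
    ‖d.F (d.O.toFun x t)‖ ^ 2 = 1 - t * (d.Γ.a / 2) := by
  rw [d.norm_sq_eq, d.f_toFun x ht]

/-- `3a/4 ≤ 1` (evaluate `f ≤ 1` at height `3/2`). [folklore] -/
theorem a_le : 3 * d.Γ.a / 4 ≤ 1 := by
  obtain ⟨x⟩ := ‹Nonempty (bdry S).carrier›
  have h := d.norm_sq_toFun x (t := 3 / 2) ⟨by norm_num, by norm_num⟩
  nlinarith [sq_nonneg ‖d.F (d.O.toFun x (3 / 2))‖]

/-- Points of collar time `< 2` lie in the region. [folklore] -/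
theorem mem_region_of_tfun_lt {z : S} (hz : d.tfun z < 2) : z ∈ d.O.region := by
  rw [mem_region_iff, d.f_eq_tfun]
  nlinarith [d.a_pos]

/-- In the zone `t < 3/2`, `f < 1`. [folklore] -/
theorem f_lt_one_of_tfun_lt {z : S} (hz : d.tfun z < 3 / 2) : d.D.f z < 1 := by
  rw [d.f_eq_tfun]
  nlinarith [d.a_pos, d.a_le, d.tfun_nonneg z]

/-- In the zone `t < 3/2`, `F z ≠ 0`. [folklore] -/
theorem F_ne_zero_of_tfun_lt {z : S} (hz : d.tfun z < 3 / 2) : d.F z ≠ 0 := by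
  intro h
  have := d.norm_sq_eq z
  rw [h, norm_zero] at this
  linarith [d.f_lt_one_of_tfun_lt hz]

/-- `t (toFun x s) = s`. [folklore] -/
theorem tfun_toFun (x : (bdry S).carrier) {s : ℝ} (hs : s ∈ Ico (0 : ℝ) 2) :
    d.tfun (d.O.toFun x s) = s :=
  d.O.height_apply x s hs

/-- `proj (toFun x s) = x`. [folklore] -/
theorem proj_toFun (x : (bdry S).carrier) {s : ℝ} (hs : s ∈ Ico (0 : ℝ) 2) :
    d.O.proj (d.O.toFun x s) = x :=
  d.O.proj_apply x s hs

/-- `toFun (proj z) (t z) = z` on the region. [folklore] -/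
theorem toFun_proj_tfun {z : S} (hz : z ∈ d.O.region) : d.O.toFun (d.O.proj z) (d.tfun z) = z :=
  d.O.apply_proj_height z hz

/-- `toFun x 0 = x`. [folklore] -/
theorem toFun_zero (x : (bdry S).carrier) : d.O.toFun x 0 = (bdry S).incl x :=
  d.O.apply_zero x

/-- The carrier of the boundary datum *is* the boundary subtype `∂S` (the identity map, recorded
to mediate between the two spellings `𝓡∂ (1 + 1)` and `𝓡∂ 2`). [folklore] -/
def toBdry (x : (bdry S).carrier) : ↥((𝓡∂ 2).boundary S) := x

omit [T2Space S] [Nonempty (bdry S).carrier] in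
/-- The inclusion of the boundary datum is the subtype inclusion. [folklore] -/
theorem incl_eq (x : (bdry S).carrier) : (bdry S).incl x = ((toBdry x : ↥((𝓡∂ 2).boundary S)) : S) :=
  rfl

/-! ### The pushed collar point and the frozen map -/

/-- The **push along the collar**: `Λ z = toFun (proj z) (c₂ (t z))`. [folklore] -/
def push (z : S) : S :=
  d.O.toFun (d.O.proj z) (frz (d.tfun z))

omit [T2Space S] [Nonempty (bdry S).carrier] in
/-- In the zone `t < 3/2`, `c₂ (t z) ∈ [0, 2)`. [folklore] -/
theorem frz_tfun_mem {z : S} (hz : d.tfun z < 3 / 2) : frz (d.tfun z) ∈ Ico (0 : ℝ) 2 :=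
  ⟨frz_nonneg (d.tfun_nonneg z), (frz_le (d.tfun_nonneg z)).trans_lt (by linarith)⟩

/-- `‖F (Λ z)‖² = 1 - c₂(t z) a / 2`. [folklore] -/
theorem norm_sq_push {z : S} (hz : d.tfun z < 3 / 2) :
    ‖d.F (d.push z)‖ ^ 2 = 1 - frz (d.tfun z) * (d.Γ.a / 2) :=
  d.norm_sq_toFun _ (d.frz_tfun_mem hz)

/-- In the zone, `F (Λ z) ≠ 0`. [folklore] -/
theorem F_push_ne_zero {z : S} (hz : d.tfun z < 3 / 2) : d.F (d.push z) ≠ 0 := by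
  intro h
  have h1 := d.norm_sq_push hz
  rw [h, norm_zero] at h1
  have h2 := d.f_lt_one_of_tfun_lt hz
  rw [d.f_eq_tfun] at h2
  nlinarith [frz_le (d.tfun_nonneg z), d.a_pos]

/-- `t (Λ z) = c₂ (t z)` in the zone. [folklore] -/
theorem tfun_push {z : S} (hz : d.tfun z < 3 / 2) : d.tfun (d.push z) = frz (d.tfun z) :=
  d.tfun_toFun _ (d.frz_tfun_mem hz)

/-- `proj (Λ z) = proj z` in the zone. [folklore] -/
theorem proj_push {z : S} (hz : d.tfun z < 3 / 2) : d.O.proj (d.push z) = d.O.proj z :=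
  d.proj_toFun _ (d.frz_tfun_mem hz)

/-- The **frozen map**: in the zone `t z < 1` the point `F (Λ z)` rescaled to the level of `z`,
`(‖F z‖ / ‖F (Λ z)‖) • F (Λ z)`; elsewhere `F z`. [folklore] -/
def newMap (z : S) : 𝔼 4 :=
  if d.tfun z < 1 then (‖d.F z‖ / ‖d.F (d.push z)‖) • d.F (d.push z) else d.F z

/-- **The formula holds on the whole zone `t < 3/2`** (for `1 ≤ t` the push is trivial). [folklore] -/
theorem newMap_of_tfun_lt {z : S} (hz : d.tfun z < 3 / 2) :
    d.newMap z = (‖d.F z‖ / ‖d.F (d.push z)‖) • d.F (d.push z) := by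
  unfold newMap
  split_ifs with h
  · rfl
  · have h1 : 1 ≤ d.tfun z := le_of_not_gt h
    have hp : d.push z = z := by
      unfold push
      rw [frz_of_ge h1]
      exact d.toFun_proj_tfun (d.mem_region_of_tfun_lt (by linarith))
    rw [hp, div_self (norm_ne_zero_iff.2 (d.F_ne_zero_of_tfun_lt hz)), one_smul]

/-- **The frozen map is `F` for `t ≥ 1`.** [folklore] -/
theorem newMap_of_one_le {z : S} (hz : 1 ≤ d.tfun z) : d.newMap z = d.F z := by
  unfold newMap
  rw [if_neg (not_lt.2 hz)]

/-- The push is the boundary point `proj z` for `t ≤ 1/2`. [folklore] -/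
theorem push_of_le_half {z : S} (hz : d.tfun z ≤ 1 / 2) :
    d.push z = ((toBdry (d.O.proj z) : ↥((𝓡∂ 2).boundary S)) : S) := by
  unfold push
  rw [frz_of_le hz, d.toFun_zero]
  rfl

/-- **The frozen map is the cone for `t ≤ 1/2`**: `‖F z‖ • K (e (proj z))`. [folklore] -/
theorem newMap_of_le_half {z : S} (hz : d.tfun z ≤ 1 / 2) :
    d.newMap z = ‖d.F z‖ • ((K (d.e (toBdry (d.O.proj z))) : 𝕊 3) : 𝔼 4) := by
  rw [d.newMap_of_tfun_lt (by linarith), d.push_of_le_half hz, d.bdryEq, norm_eq_of_mem_sphere,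
    div_one]

/-- **The frozen map preserves levels**: `‖newMap z‖ = ‖F z‖`. [folklore] -/
theorem norm_newMap (z : S) : ‖d.newMap z‖ = ‖d.F z‖ := by
  rcases lt_or_ge (d.tfun z) (3 / 2) with hz | hz
  · rw [d.newMap_of_tfun_lt hz, norm_smul, Real.norm_of_nonneg (by positivity),
      div_mul_cancel₀ _ (norm_ne_zero_iff.2 (d.F_push_ne_zero hz))]
  · rw [d.newMap_of_one_le (by linarith)]


/-! ### The zone and its complement; smoothness of the frozen map -/

omit [T2Space S] [Nonempty (bdry S).carrier] in
/-- The zone `Z = {t < 3/2}` is open. [folklore] -/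
theorem isOpen_zone : IsOpen {z : S | d.tfun z < 3 / 2} :=
  isOpen_lt d.continuous_tfun continuous_const

omit [T2Space S] [Nonempty (bdry S).carrier] in
/-- The far set `W = {1 < t}` is open. [folklore] -/
theorem isOpen_far : IsOpen {z : S | 1 < d.tfun z} :=
  isOpen_lt continuous_const d.continuous_tfun

/-- The zone lies in the region of the collar. [folklore] -/
theorem zone_subset_region : {z : S | d.tfun z < 3 / 2} ⊆ d.O.region := fun _ hz ↦
  d.mem_region_of_tfun_lt (lt_trans hz (by norm_num))

/-- `proj` is `C^∞` on the region (model `𝓡 1` on `∂S`). [folklore] -/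
theorem contMDiffOn_proj : ContMDiffOn (𝓡∂ 2) (𝓡 1) ∞ d.O.proj d.O.region :=
  d.O.contMDiffOn_proj

/-- The collar map is `C^∞` on `∂S × [0, 2)`. [folklore] -/
theorem contMDiffOn_toFun :
    ContMDiffOn ((𝓡 1).prod 𝓘(ℝ, ℝ)) (𝓡∂ 2) ∞ (uncurry d.O.toFun) (univ ×ˢ Ico (0 : ℝ) 2) :=
  d.O.contMDiffOn_toFun

/-- **The push is `C^∞` on the zone.** [folklore] -/
theorem contMDiffOn_push : ContMDiffOn (𝓡∂ 2) (𝓡∂ 2) ∞ d.push {z : S | d.tfun z < 3 / 2} := by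
  have hpair : ContMDiffOn (𝓡∂ 2) ((𝓡 1).prod 𝓘(ℝ, ℝ)) ∞
      (fun z ↦ (d.O.proj z, frz (d.tfun z))) {z : S | d.tfun z < 3 / 2} :=
    (d.contMDiffOn_proj.mono d.zone_subset_region).prodMk
      ((contDiff_frz.comp_contMDiff d.contMDiff_tfun).contMDiffOn)
  exact d.contMDiffOn_toFun.comp hpair fun z hz ↦ ⟨mem_univ _, d.frz_tfun_mem hz⟩

/-- The formula of the frozen map. [folklore] -/
def formula (z : S) : 𝔼 4 :=
  (‖d.F z‖ / ‖d.F (d.push z)‖) • d.F (d.push z)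

/-- **The formula is `C^∞` on the zone.** [folklore] -/
theorem contMDiffOn_formula : ContMDiffOn (𝓡∂ 2) 𝓘(ℝ, 𝔼 4) ∞ d.formula {z : S | d.tfun z < 3 / 2} := by
  intro z hz
  have hFp : ContMDiffWithinAt (𝓡∂ 2) 𝓘(ℝ, 𝔼 4) ∞ (d.F ∘ d.push) {z : S | d.tfun z < 3 / 2} z :=
    d.smooth.contMDiffAt.comp_contMDiffWithinAt z (d.contMDiffOn_push z hz)
  have hnF : ContMDiffWithinAt (𝓡∂ 2) 𝓘(ℝ, ℝ) ∞ (fun z ↦ ‖d.F z‖) {z : S | d.tfun z < 3 / 2} z :=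
    ContDiffAt.comp_contMDiffWithinAt (g := norm) (f := d.F)
      (contDiffAt_norm ℝ (d.F_ne_zero_of_tfun_lt hz)) d.smooth.contMDiffAt.contMDiffWithinAt
  have hnG : ContMDiffWithinAt (𝓡∂ 2) 𝓘(ℝ, ℝ) ∞ (fun z ↦ ‖d.F (d.push z)‖)
      {z : S | d.tfun z < 3 / 2} z :=
    ContDiffAt.comp_contMDiffWithinAt (g := norm) (f := d.F ∘ d.push)
      (contDiffAt_norm ℝ (d.F_push_ne_zero hz)) hFp
  have hq : ContDiffAt ℝ ∞ (fun q : ℝ × ℝ ↦ q.1 / q.2) (‖d.F z‖, ‖d.F (d.push z)‖) :=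
    contDiffAt_fst.div contDiffAt_snd (norm_ne_zero_iff.2 (d.F_push_ne_zero hz))
  have hsc : ContMDiffWithinAt (𝓡∂ 2) 𝓘(ℝ, ℝ) ∞ (fun z ↦ ‖d.F z‖ / ‖d.F (d.push z)‖)
      {z : S | d.tfun z < 3 / 2} z :=
    ContDiffAt.comp_contMDiffWithinAt (g := fun q : ℝ × ℝ ↦ q.1 / q.2)
      (f := fun z ↦ (‖d.F z‖, ‖d.F (d.push z)‖)) (x := z) hq (hnF.prodMk_space hnG)
  exact hsc.smul hFp

/-- **The frozen map is `C^∞`.** [folklore] -/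
theorem contMDiff_newMap : ContMDiff (𝓡∂ 2) 𝓘(ℝ, 𝔼 4) ∞ d.newMap := by
  intro z
  rcases lt_or_ge (d.tfun z) (3 / 2) with hz | hz
  · have hev : d.newMap =ᶠ[𝓝 z] d.formula := by
      filter_upwards [d.isOpen_zone.mem_nhds hz] with q hq using d.newMap_of_tfun_lt hq
    exact ((d.contMDiffOn_formula z hz).contMDiffAt (d.isOpen_zone.mem_nhds hz)).congr_of_eventuallyEq
      hev
  · have hz1 : 1 < d.tfun z := by linarith
    have hev : d.newMap =ᶠ[𝓝 z] d.F := by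
      filter_upwards [d.isOpen_far.mem_nhds hz1] with q hq using d.newMap_of_one_le (le_of_lt hq)
    exact d.smooth.contMDiffAt.congr_of_eventuallyEq hev

/-! ### Injectivity, boundary values, interior, radiality -/

omit [T2Space S] [Nonempty (bdry S).carrier] in
/-- The collar time is determined by the level. [folklore] -/
theorem tfun_eq_of_norm_eq {z z' : S} (h : ‖d.F z‖ = ‖d.F z'‖) : d.tfun z = d.tfun z' := by
  unfold tfun
  rw [d.f_apply, d.f_apply, h]

/-- **The frozen map is injective.** [folklore] -/
theorem injective_newMap : Injective d.newMap := by
  intro z z' h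
  have hn : ‖d.F z‖ = ‖d.F z'‖ := by rw [← d.norm_newMap z, ← d.norm_newMap z', h]
  have ht : d.tfun z = d.tfun z' := d.tfun_eq_of_norm_eq hn
  rcases le_or_gt 1 (d.tfun z) with h1 | h1
  · rw [d.newMap_of_one_le h1, d.newMap_of_one_le (ht ▸ h1)] at h
    exact d.inj h
  · have hz : d.tfun z < 3 / 2 := by linarith
    have hz' : d.tfun z' < 3 / 2 := by linarith
    rw [d.newMap_of_tfun_lt hz, d.newMap_of_tfun_lt hz'] at h
    -- the two pushes lie at the same level
    have hnp : ‖d.F (d.push z)‖ = ‖d.F (d.push z')‖ := by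
      have h2 : ‖d.F (d.push z)‖ ^ 2 = ‖d.F (d.push z')‖ ^ 2 := by
        rw [d.norm_sq_push hz, d.norm_sq_push hz', ht]
      exact (pow_left_inj₀ (norm_nonneg _) (norm_nonneg _) two_ne_zero).1 h2
    rw [hn, hnp] at h
    have hs : ‖d.F z'‖ / ‖d.F (d.push z')‖ ≠ 0 :=
      div_ne_zero (norm_ne_zero_iff.2 (d.F_ne_zero_of_tfun_lt hz'))
        (norm_ne_zero_iff.2 (d.F_push_ne_zero hz'))
    have hp : d.push z = d.push z' := d.inj (smul_right_injective (𝔼 4) hs h)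
    have hproj : d.O.proj z = d.O.proj z' := by
      have hp' := hp
      unfold push at hp'
      exact (d.O.eq_of_apply_eq (d.frz_tfun_mem hz) (d.frz_tfun_mem hz') hp').1
    calc z = d.O.toFun (d.O.proj z) (d.tfun z) := (d.toFun_proj_tfun (d.zone_subset_region hz)).symm
      _ = d.O.toFun (d.O.proj z') (d.tfun z') := by rw [hproj, ht]
      _ = z' := d.toFun_proj_tfun (d.zone_subset_region hz')

/-- The identification of `∂S` with the carrier of the boundary datum, inverse to `toBdry`. [folklore] -/
def ofBdry (x : ↥((𝓡∂ 2).boundary S)) : (bdry S).carrier := x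

omit [T2Space S] [Nonempty (bdry S).carrier] in
/-- `toBdry (ofBdry x) = x`. [folklore] -/
@[simp]
theorem toBdry_ofBdry (x : ↥((𝓡∂ 2).boundary S)) : toBdry (ofBdry x) = x := rfl

/-- `proj` of a boundary point is the point. [folklore] -/
theorem proj_coe (x : ↥((𝓡∂ 2).boundary S)) : d.O.proj (x : S) = ofBdry x := by
  have h := d.proj_toFun (ofBdry x) (s := 0) ⟨le_rfl, by norm_num⟩
  rwa [d.toFun_zero] at h

/-- **Boundary values of the frozen map**: `newMap = K ∘ e` on `∂S`. [folklore] -/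
theorem newMap_coe (x : ↥((𝓡∂ 2).boundary S)) : d.newMap x = ((K (d.e x) : 𝕊 3) : 𝔼 4) := by
  have h0 : d.tfun x = 0 := (d.tfun_eq_zero_iff x).2 x.2
  rw [d.newMap_of_le_half (by rw [h0]; norm_num), d.proj_coe, toBdry_ofBdry, d.bdryEq,
    norm_eq_of_mem_sphere, one_smul]

/-- The frozen map sends the interior into the open ball. [folklore] -/
theorem norm_newMap_lt {z : S} (hz : z ∈ (𝓡∂ 2).interior S) : ‖d.newMap z‖ < 1 := by
  rw [d.norm_newMap]
  exact d.interior_lt z hz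

/-- The width of the radial band, `a/8`. [folklore] -/
def δ₀ : ℝ := d.Γ.a / 8

omit [T2Space S] [Nonempty (bdry S).carrier] in
/-- `0 < δ₀`. [folklore] -/
theorem δ₀_pos : 0 < d.δ₀ := by
  unfold δ₀
  linarith [d.a_pos]

/-- **In the radial band the collar time is `< 1/2`.** [folklore] -/
theorem tfun_lt_half_of_band {z : S} (hz : 1 - d.δ₀ < ‖d.newMap z‖) : d.tfun z < 1 / 2 := by
  rw [d.norm_newMap] at hz
  unfold δ₀ at hz
  have ha := d.a_pos
  have ha' := d.a_le
  have h1 : 0 < 1 - d.Γ.a / 8 := by linarith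
  have h2 : (1 - d.Γ.a / 8) ^ 2 < ‖d.F z‖ ^ 2 := by nlinarith [norm_nonneg (d.F z)]
  have h3 := d.norm_sq_eq z
  rw [d.f_eq_tfun] at h3
  nlinarith [d.tfun_nonneg z]

/-- The **angular map** `π = e ∘ proj`. [folklore] -/
def ang (z : S) : 𝕊 1 := d.e (toBdry (d.O.proj z))

/-- **Radiality in the band**: `newMap z = ‖newMap z‖ • K (π z)`. [folklore] -/
theorem newMap_eq_smul_of_band {z : S} (hz : 1 - d.δ₀ < ‖d.newMap z‖) :
    d.newMap z = ‖d.newMap z‖ • ((K (d.ang z) : 𝕊 3) : 𝔼 4) := by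
  rw [d.norm_newMap, ang]
  exact d.newMap_of_le_half (d.tfun_lt_half_of_band hz).le

omit [T2Space S] [Nonempty (bdry S).carrier] in
/-- **The boundary identification `e` is `C^∞`** as a map from the carrier of the boundary datum:
`K ∘ e = F|∂S` is smooth and `K` is an immersion (`ContMDiff.iff_comp_isImmersion`). [folklore] -/
theorem contMDiff_e : ContMDiff (𝓡 1) (𝓡 1) ∞ fun x : (bdry S).carrier ↦ d.e (toBdry x) := by
  haveI := Fact.mk (@finrank_euclideanSpace_fin ℝ _ (3 + 1))
  have hg : ContMDiff (𝓡 1) 𝓘(ℝ, 𝔼 4) ∞ fun x : (bdry S).carrier ↦ d.F ((bdry S).incl x) :=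
    d.smooth.comp (bdry S).isSmoothEmbedding.contMDiff
  have hmem : ∀ x : (bdry S).carrier, d.F ((bdry S).incl x) ∈ Metric.sphere (0 : 𝔼 4) 1 := by
    intro x
    rw [incl_eq, d.bdryEq]
    exact (K (d.e (toBdry x))).2
  have hc := hg.codRestrict_sphere (E := 𝔼 (3 + 1)) (n := 3) hmem
  have heq : (Set.codRestrict _ _ hmem : (bdry S).carrier → 𝕊 3) =
      fun x ↦ K (d.e (toBdry x)) := by
    funext x
    apply Subtype.ext
    show d.F ((bdry S).incl x) = _
    rw [incl_eq, d.bdryEq]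
  rw [heq] at hc
  have hcont : Continuous fun x : (bdry S).carrier ↦ d.e (toBdry x) :=
    d.e.continuous.comp continuous_id
  exact ((ContMDiff.iff_comp_isImmersion K.isSmoothEmbedding.isImmersion).2 ⟨hcont, hc⟩)

/-- **The angular map is `C^∞` on the region**, in particular on the radial band. [folklore] -/
theorem contMDiffOn_ang : ContMDiffOn (𝓡∂ 2) (𝓡 1) ∞ d.ang d.O.region :=
  d.contMDiff_e.comp_contMDiffOn d.contMDiffOn_proj

/-- The radial band lies in the region. [folklore] -/
theorem band_subset_region : {z : S | 1 - d.δ₀ < ‖d.newMap z‖} ⊆ d.O.region := fun _ hz ↦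
  d.mem_region_of_tfun_lt (by linarith [d.tfun_lt_half_of_band hz])


/-! ### The differential of the frozen map is injective

Notation for this section: `T = uncurry toFun : ∂S × ℝ → S` (smooth on `A = ∂S × [0, 2)`),
`P = (proj, t) : S → ∂S × ℝ` (smooth on the region), inverse to each other; the level circles
`circ s = toFun (·, s)`. -/

/-- The norm of the formula is the level `‖F‖`. [folklore] -/
theorem norm_formula {z : S} (hz : d.tfun z < 3 / 2) : ‖d.formula z‖ = ‖d.F z‖ := by
  rw [formula, norm_smul, Real.norm_of_nonneg (by positivity),
    div_mul_cancel₀ _ (norm_ne_zero_iff.2 (d.F_push_ne_zero hz))]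

/-- The **level circle** at collar time `s`: `x ↦ toFun x s`. [folklore] -/
def circ (s : ℝ) (x : (bdry S).carrier) : S :=
  d.O.toFun x s

omit [T2Space S] [Nonempty (bdry S).carrier] in
/-- The set `A = ∂S × [0, 2)` on which the collar map is smooth has unique derivatives. [folklore] -/
theorem uniqueMDiffWithinAt_A (x : (bdry S).carrier) {s : ℝ} (hs : s ∈ Ico (0 : ℝ) 2) :
    UniqueMDiffWithinAt ((𝓡 1).prod 𝓘(ℝ, ℝ)) ((univ : Set (bdry S).carrier) ×ˢ Ico (0 : ℝ) 2)
      ((x, s) : (bdry S).carrier × ℝ) :=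
  (uniqueMDiffWithinAt_univ (𝓡 1)).prod
    (uniqueMDiffWithinAt_iff_uniqueDiffWithinAt.2 (uniqueDiffOn_Ico 0 2 s hs))

/-- **The differential of a level circle** is `DT ∘ inl` for the derivative `DT` of the collar
map within `A`. [folklore] -/
theorem hasMFDerivAt_circ (x : (bdry S).carrier) {s : ℝ} (hs : s ∈ Ico (0 : ℝ) 2)
    {L : TangentSpace ((𝓡 1).prod 𝓘(ℝ, ℝ)) ((x, s) : (bdry S).carrier × ℝ) →L[ℝ]
      TangentSpace (𝓡∂ 2) (uncurry d.O.toFun ((x, s) : (bdry S).carrier × ℝ))}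
    (hL : HasMFDerivWithinAt ((𝓡 1).prod 𝓘(ℝ, ℝ)) (𝓡∂ 2) (uncurry d.O.toFun)
      ((univ : Set (bdry S).carrier) ×ˢ Ico (0 : ℝ) 2) ((x, s) : (bdry S).carrier × ℝ) L) :
    HasMFDerivAt (𝓡 1) (𝓡∂ 2) (d.circ s) x
      (L.comp (ContinuousLinearMap.inl ℝ (TangentSpace (𝓡 1) x) (TangentSpace 𝓘(ℝ, ℝ) s))) := by
  have hι : HasMFDerivAt (𝓡 1) ((𝓡 1).prod 𝓘(ℝ, ℝ))
      (fun y : (bdry S).carrier ↦ ((y, s) : (bdry S).carrier × ℝ)) x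
      (ContinuousLinearMap.inl ℝ (TangentSpace (𝓡 1) x) (TangentSpace 𝓘(ℝ, ℝ) s)) :=
    (hasMFDerivAt_id (I := 𝓡 1) x).prodMk (hasMFDerivAt_const (I := 𝓡 1) (I' := 𝓘(ℝ, ℝ)) s x)
  have h := hL.comp x (hι.hasMFDerivWithinAt (s := univ)) fun y _ ↦
    show ((y, s) : (bdry S).carrier × ℝ) ∈ (univ : Set (bdry S).carrier) ×ˢ Ico (0 : ℝ) 2 from
      mk_mem_prod (mem_univ _) hs
  exact hasMFDerivWithinAt_univ.1 h

/-- **The differential of the collar map within `A` is injective**: `P ∘ T = id` on `A` with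
`P = (proj, t)` smooth near `T (x, s)`. [folklore] -/
theorem injective_of_hasMFDerivWithinAt_toFun (x : (bdry S).carrier) {s : ℝ}
    (hs : s ∈ Ico (0 : ℝ) 2)
    {L : TangentSpace ((𝓡 1).prod 𝓘(ℝ, ℝ)) ((x, s) : (bdry S).carrier × ℝ) →L[ℝ]
      TangentSpace (𝓡∂ 2) (uncurry d.O.toFun ((x, s) : (bdry S).carrier × ℝ))}
    (hL : HasMFDerivWithinAt ((𝓡 1).prod 𝓘(ℝ, ℝ)) (𝓡∂ 2) (uncurry d.O.toFun)
      ((univ : Set (bdry S).carrier) ×ˢ Ico (0 : ℝ) 2) ((x, s) : (bdry S).carrier × ℝ) L) :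
    Injective L := by
  have hreg : d.O.toFun x s ∈ d.O.region := d.O.mem_region x s hs
  have hdproj : MDifferentiableAt (𝓡∂ 2) (𝓡 1) d.O.proj (d.O.toFun x s) :=
    (d.contMDiffOn_proj.contMDiffAt (d.O.isOpen_region.mem_nhds hreg)).mdifferentiableAt (by simp)
  have hdtfun : MDifferentiableAt (𝓡∂ 2) 𝓘(ℝ, ℝ) d.tfun (d.O.toFun x s) :=
    d.contMDiff_tfun.mdifferentiableAt (by simp)
  set DP := (mfderiv (𝓡∂ 2) (𝓡 1) d.O.proj (d.O.toFun x s)).prod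
    (mfderiv (𝓡∂ 2) 𝓘(ℝ, ℝ) d.tfun (d.O.toFun x s)) with hDP
  have hP : HasMFDerivAt (𝓡∂ 2) ((𝓡 1).prod 𝓘(ℝ, ℝ)) (fun z ↦ (d.O.proj z, d.tfun z))
      (uncurry d.O.toFun ((x, s) : (bdry S).carrier × ℝ)) DP :=
    hdproj.hasMFDerivAt.prodMk hdtfun.hasMFDerivAt
  have hcomp := hP.comp_hasMFDerivWithinAt _ hL
  have hid := hasMFDerivWithinAt_id (I := (𝓡 1).prod 𝓘(ℝ, ℝ))
    ((univ : Set (bdry S).carrier) ×ˢ Ico (0 : ℝ) 2) ((x, s) : (bdry S).carrier × ℝ)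
  have hev : (id : (bdry S).carrier × ℝ → (bdry S).carrier × ℝ) =ᶠ[𝓝[(univ : Set (bdry S).carrier) ×ˢ Ico (0 : ℝ) 2] ((x, s) : (bdry S).carrier × ℝ)]
      ((fun z ↦ (d.O.proj z, d.tfun z)) ∘ uncurry d.O.toFun) := by
    refine Filter.eventually_of_mem self_mem_nhdsWithin fun q hq ↦ ?_
    obtain ⟨y, σ⟩ := q
    obtain ⟨-, hσ⟩ := hq
    exact Prod.ext (d.proj_toFun y hσ).symm (d.tfun_toFun y hσ).symm
  have hcongr := hcomp.congr_of_eventuallyEq hev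
    (Prod.ext (d.proj_toFun x hs).symm (d.tfun_toFun x hs).symm)
  have heq := (uniqueMDiffWithinAt_A x hs).eq hid hcongr
  intro v w hvw
  have e₁ : v = DP (L v) := DFunLike.congr_fun heq v
  have e₂ : w = DP (L w) := DFunLike.congr_fun heq w
  have e₃ : DP (L v) = DP (L w) := by rw [hvw]
  exact e₁.trans (e₃.trans e₂.symm)

set_option maxHeartbeats 400000 in  -- ns-align 2026-08-14: sat at the 200k edge; longer qualified names in the statement tipped `whnf` over (proof and statement unchanged)
/-- **`DT ∘ DP = id` at points of the region written as `toFun x₀ t₀`**: `T ∘ P = id` near the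
point, `P` differentiable there, `T` differentiable within `A` at `P` of the point. [folklore] -/
theorem apply_prod_apply_eq (x₀ : (bdry S).carrier) {t₀ : ℝ} (ht₀ : t₀ ∈ Ico (0 : ℝ) 2)
    {L : TangentSpace ((𝓡 1).prod 𝓘(ℝ, ℝ)) ((x₀, t₀) : (bdry S).carrier × ℝ) →L[ℝ]
      TangentSpace (𝓡∂ 2) (uncurry d.O.toFun ((x₀, t₀) : (bdry S).carrier × ℝ))}
    (hL : HasMFDerivWithinAt ((𝓡 1).prod 𝓘(ℝ, ℝ)) (𝓡∂ 2) (uncurry d.O.toFun)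
      ((univ : Set (bdry S).carrier) ×ˢ Ico (0 : ℝ) 2) ((x₀, t₀) : (bdry S).carrier × ℝ) L)
    (w : TangentSpace (𝓡∂ 2) (d.O.toFun x₀ t₀)) :
    L ((mfderiv (𝓡∂ 2) (𝓡 1) d.O.proj (d.O.toFun x₀ t₀) w,
      mfderiv (𝓡∂ 2) 𝓘(ℝ, ℝ) d.tfun (d.O.toFun x₀ t₀) w) :
        TangentSpace (𝓡 1) x₀ × ℝ) = w := by
  have hreg : d.O.toFun x₀ t₀ ∈ d.O.region := d.O.mem_region x₀ t₀ ht₀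
  have hproj : d.O.proj (d.O.toFun x₀ t₀) = x₀ := d.proj_toFun x₀ ht₀
  have htf : d.tfun (d.O.toFun x₀ t₀) = t₀ := d.tfun_toFun x₀ ht₀
  have hdproj : MDifferentiableAt (𝓡∂ 2) (𝓡 1) d.O.proj (d.O.toFun x₀ t₀) :=
    (d.contMDiffOn_proj.contMDiffAt (d.O.isOpen_region.mem_nhds hreg)).mdifferentiableAt (by simp)
  have hdtfun : MDifferentiableAt (𝓡∂ 2) 𝓘(ℝ, ℝ) d.tfun (d.O.toFun x₀ t₀) :=
    d.contMDiff_tfun.mdifferentiableAt (by simp)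
  have hP : HasMFDerivAt (𝓡∂ 2) ((𝓡 1).prod 𝓘(ℝ, ℝ)) (fun z ↦ (d.O.proj z, d.tfun z))
      (d.O.toFun x₀ t₀)
      ((mfderiv (𝓡∂ 2) (𝓡 1) d.O.proj (d.O.toFun x₀ t₀)).prod
        (mfderiv (𝓡∂ 2) 𝓘(ℝ, ℝ) d.tfun (d.O.toFun x₀ t₀))) :=
    hdproj.hasMFDerivAt.prodMk hdtfun.hasMFDerivAt
  -- `hL` at the point `P (toFun x₀ t₀) = (x₀, t₀)`
  have hL' : HasMFDerivWithinAt ((𝓡 1).prod 𝓘(ℝ, ℝ)) (𝓡∂ 2) (uncurry d.O.toFun)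
      ((univ : Set (bdry S).carrier) ×ˢ Ico (0 : ℝ) 2)
      ((fun z ↦ (d.O.proj z, d.tfun z)) (d.O.toFun x₀ t₀)) L := by
    show HasMFDerivWithinAt ((𝓡 1).prod 𝓘(ℝ, ℝ)) (𝓡∂ 2) (uncurry d.O.toFun)
      ((univ : Set (bdry S).carrier) ×ˢ Ico (0 : ℝ) 2)
      ((d.O.proj (d.O.toFun x₀ t₀), d.tfun (d.O.toFun x₀ t₀)) : (bdry S).carrier × ℝ) L
    rw [hproj, htf]
    exact hL
  have hcomp := hL'.comp (d.O.toFun x₀ t₀) (hP.hasMFDerivWithinAt (s := d.O.region))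
    fun q hq ↦ show ((d.O.proj q, d.tfun q) : (bdry S).carrier × ℝ) ∈
        (univ : Set (bdry S).carrier) ×ˢ Ico (0 : ℝ) 2 from
      mk_mem_prod (mem_univ _) (d.O.height_mem q hq)
  have hid := hasMFDerivWithinAt_id (I := 𝓡∂ 2) d.O.region (d.O.toFun x₀ t₀)
  have hev : (id : S → S) =ᶠ[𝓝[d.O.region] (d.O.toFun x₀ t₀)]
      (uncurry d.O.toFun ∘ fun z ↦ (d.O.proj z, d.tfun z)) :=
    Filter.eventually_of_mem self_mem_nhdsWithin fun q hq ↦ (d.toFun_proj_tfun hq).symm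
  have hcongr := hcomp.congr_of_eventuallyEq hev (d.toFun_proj_tfun hreg).symm
  have heq := (d.O.isOpen_region.uniqueMDiffWithinAt hreg).eq hid hcongr
  have e := DFunLike.congr_fun heq w
  exact e.symm

/-- **The radial component**: on the zone `‖formula‖² = 1 - (a/2) t`, so
`⟪formula z, D(formula) w⟫ = -(a/4) · Dt w`; in particular `D(formula) w = 0` forces
`Dt w = 0`. [folklore] -/
theorem mfderiv_tfun_eq_zero {z : S} (hz : d.tfun z < 3 / 2) {w : TangentSpace (𝓡∂ 2) z}
    (hw : mfderiv (𝓡∂ 2) 𝓘(ℝ, 𝔼 4) d.formula z w = 0) :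
    mfderiv (𝓡∂ 2) 𝓘(ℝ, ℝ) d.tfun z w = 0 := by
  have hΦd : MDifferentiableAt (𝓡∂ 2) 𝓘(ℝ, 𝔼 4) d.formula z :=
    ((d.contMDiffOn_formula z hz).contMDiffAt (d.isOpen_zone.mem_nhds hz)).mdifferentiableAt
      (by simp)
  have hdtfun : MDifferentiableAt (𝓡∂ 2) 𝓘(ℝ, ℝ) d.tfun z := d.contMDiff_tfun.mdifferentiableAt (by simp)
  -- the two functions agree on the zone
  have hev : (fun q ↦ ‖d.formula q‖ ^ 2) =ᶠ[𝓝 z]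
      ((fun _ ↦ (1 : ℝ)) - (d.Γ.a / 2) • d.tfun) := by
    filter_upwards [d.isOpen_zone.mem_nhds hz] with q hq
    simp only [Pi.sub_apply, Pi.smul_apply, smul_eq_mul]
    rw [d.norm_formula hq, d.norm_sq_eq, d.f_eq_tfun]
    ring
  have h1 : HasMFDerivAt (𝓡∂ 2) 𝓘(ℝ, ℝ) (fun q ↦ ‖d.formula q‖ ^ 2) z
      ((2 • innerSL ℝ (d.formula z)).comp (mfderiv (𝓡∂ 2) 𝓘(ℝ, 𝔼 4) d.formula z)) :=
    (hasStrictFDerivAt_norm_sq (d.formula z)).hasFDerivAt.hasMFDerivAt.comp z hΦd.hasMFDerivAt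
  have h2 := (hasMFDerivAt_const (I := 𝓡∂ 2) (I' := 𝓘(ℝ, ℝ)) (1 : ℝ) z).sub
      (hdtfun.hasMFDerivAt.const_smul (d.Γ.a / 2))
  have heq := hev.mfderiv_eq (I := 𝓡∂ 2) (I' := 𝓘(ℝ, ℝ))
  rw [h1.mfderiv, h2.mfderiv] at heq
  set r : ℝ := mfderiv (𝓡∂ 2) 𝓘(ℝ, ℝ) d.tfun z w with hr
  have e : (2 • innerSL ℝ (d.formula z)) ((mfderiv (𝓡∂ 2) 𝓘(ℝ, 𝔼 4) d.formula z w :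
      TangentSpace 𝓘(ℝ, 𝔼 4) (d.formula z)) : 𝔼 4) = 0 - d.Γ.a / 2 * r :=
    DFunLike.congr_fun heq w
  rw [hw] at e
  have e' : (2 • innerSL ℝ (d.formula z)) (0 : 𝔼 4) = 0 - d.Γ.a / 2 * r := e
  rw [map_zero] at e'
  have ha := d.a_pos
  have : (d.Γ.a / 2) * r = 0 := by linarith
  rcases mul_eq_zero.1 this with h | h
  · exfalso; linarith
  · exact h


/-- **The differential of the formula is injective at every point `toFun x₀ t₀` of the zone.**
If `D(formula) w = 0` then `Dt w = 0` (radial component), so `w = DT (v, 0)` is tangent to the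
level circle (`apply_prod_apply_eq`); along the level circle `formula = m • F ∘ circ (c₂ t₀)` with
`m ≠ 0`, and `F ∘ circ (c₂ t₀)` is an immersion (`F` is, and `D(circ) = DT ∘ inl` with `DT`
injective), whence `v = 0`. [folklore] -/
theorem injective_mfderiv_formula (x₀ : (bdry S).carrier) {t₀ : ℝ}
    (ht₀ : t₀ ∈ Ico (0 : ℝ) (3 / 2)) :
    Injective (mfderiv (𝓡∂ 2) 𝓘(ℝ, 𝔼 4) d.formula (d.O.toFun x₀ t₀)) := by
  have ht₀' : t₀ ∈ Ico (0 : ℝ) 2 := ⟨ht₀.1, by linarith [ht₀.2]⟩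
  have hs : frz t₀ ∈ Ico (0 : ℝ) 2 :=
    ⟨frz_nonneg ht₀.1, (frz_le ht₀.1).trans_lt (by linarith [ht₀.2])⟩
  have htf : d.tfun (d.O.toFun x₀ t₀) = t₀ := d.tfun_toFun x₀ ht₀'
  have hzone : d.tfun (d.O.toFun x₀ t₀) < 3 / 2 := by rw [htf]; exact ht₀.2
  have hpush : ∀ y : (bdry S).carrier, d.push (d.O.toFun y t₀) = d.O.toFun y (frz t₀) := by
    intro y
    unfold push
    rw [d.proj_toFun y ht₀', d.tfun_toFun y ht₀']
  -- derivatives of the collar map within `A` at `(x₀, t₀)` and `(x₀, c₂ t₀)`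
  have hT := d.contMDiffOn_toFun
  obtain ⟨L, hL⟩ : ∃ L, HasMFDerivWithinAt ((𝓡 1).prod 𝓘(ℝ, ℝ)) (𝓡∂ 2) (uncurry d.O.toFun)
      ((univ : Set (bdry S).carrier) ×ˢ Ico (0 : ℝ) 2) ((x₀, t₀) : (bdry S).carrier × ℝ) L :=
    ⟨_, ((hT _ (mk_mem_prod (mem_univ _) ht₀')).mdifferentiableWithinAt
      (by simp)).hasMFDerivWithinAt⟩
  obtain ⟨L₁, hL₁⟩ : ∃ L₁, HasMFDerivWithinAt ((𝓡 1).prod 𝓘(ℝ, ℝ)) (𝓡∂ 2) (uncurry d.O.toFun)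
      ((univ : Set (bdry S).carrier) ×ˢ Ico (0 : ℝ) 2) ((x₀, frz t₀) : (bdry S).carrier × ℝ)
      L₁ :=
    ⟨_, ((hT _ (mk_mem_prod (mem_univ _) hs)).mdifferentiableWithinAt
      (by simp)).hasMFDerivWithinAt⟩
  have hcirc := d.hasMFDerivAt_circ x₀ ht₀' hL
  have hcirc₁ := d.hasMFDerivAt_circ x₀ hs hL₁
  have hInv2 := d.injective_of_hasMFDerivWithinAt_toFun x₀ hs hL₁
  -- differentiability of `formula` and `F`
  have hΦd : MDifferentiableAt (𝓡∂ 2) 𝓘(ℝ, 𝔼 4) d.formula (d.O.toFun x₀ t₀) :=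
    ((d.contMDiffOn_formula _ hzone).contMDiffAt (d.isOpen_zone.mem_nhds hzone)).mdifferentiableAt
      (by simp)
  have hFd : MDifferentiableAt (𝓡∂ 2) 𝓘(ℝ, 𝔼 4) d.F (d.O.toFun x₀ (frz t₀)) :=
    d.smooth.mdifferentiableAt (by simp)
  -- the scalar `m` and the identity `formula ∘ circ t₀ = m • F ∘ circ (c₂ t₀)`
  obtain ⟨m, hm_def⟩ : ∃ m : ℝ, m = ‖d.F (d.O.toFun x₀ t₀)‖ / ‖d.F (d.O.toFun x₀ (frz t₀))‖ :=
    ⟨_, rfl⟩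
  have hm : m ≠ 0 := by
    rw [hm_def]
    refine div_ne_zero (norm_ne_zero_iff.2 (d.F_ne_zero_of_tfun_lt hzone))
      (norm_ne_zero_iff.2 ?_)
    have h := d.F_push_ne_zero hzone
    rwa [hpush x₀] at h
  have hfun : d.formula ∘ d.circ t₀ = m • (d.F ∘ d.circ (frz t₀)) := by
    funext y
    simp only [comp_apply, Pi.smul_apply, formula, circ]
    rw [hpush y]
    have hn1 : ‖d.F (d.O.toFun y t₀)‖ = ‖d.F (d.O.toFun x₀ t₀)‖ :=
      (pow_left_inj₀ (norm_nonneg _) (norm_nonneg _) two_ne_zero).1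
        (by rw [d.norm_sq_toFun y ht₀', d.norm_sq_toFun x₀ ht₀'])
    have hn2 : ‖d.F (d.O.toFun y (frz t₀))‖ = ‖d.F (d.O.toFun x₀ (frz t₀))‖ :=
      (pow_left_inj₀ (norm_nonneg _) (norm_nonneg _) two_ne_zero).1
        (by rw [d.norm_sq_toFun y hs, d.norm_sq_toFun x₀ hs])
    rw [hn1, hn2, hm_def]
  -- the differential of `formula ∘ circ t₀` in two ways
  have h1 : mfderiv (𝓡 1) 𝓘(ℝ, 𝔼 4) (d.formula ∘ d.circ t₀) x₀ =
      (mfderiv (𝓡∂ 2) 𝓘(ℝ, 𝔼 4) d.formula (d.O.toFun x₀ t₀)).comp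
        (L.comp (ContinuousLinearMap.inl ℝ (TangentSpace (𝓡 1) x₀)
          (TangentSpace 𝓘(ℝ, ℝ) t₀))) := by
    rw [mfderiv_comp x₀ hΦd hcirc.mdifferentiableAt, hcirc.mfderiv]
    rfl
  have h2 : mfderiv (𝓡 1) 𝓘(ℝ, 𝔼 4) (d.formula ∘ d.circ t₀) x₀ =
      m • ((mfderiv (𝓡∂ 2) 𝓘(ℝ, 𝔼 4) d.F (d.O.toFun x₀ (frz t₀))).comp
        (L₁.comp (ContinuousLinearMap.inl ℝ (TangentSpace (𝓡 1) x₀)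
          (TangentSpace 𝓘(ℝ, ℝ) (frz t₀))))) := by
    rw [hfun, const_smul_mfderiv (hFd.comp x₀ hcirc₁.mdifferentiableAt),
      mfderiv_comp x₀ hFd hcirc₁.mdifferentiableAt, hcirc₁.mfderiv]
    rfl
  -- conclusion
  refine (injective_iff_map_eq_zero _).2 fun w hw ↦ ?_
  have ht0 : mfderiv (𝓡∂ 2) 𝓘(ℝ, ℝ) d.tfun (d.O.toFun x₀ t₀) w = 0 :=
    d.mfderiv_tfun_eq_zero hzone hw
  set v : TangentSpace (𝓡 1) x₀ := mfderiv (𝓡∂ 2) (𝓡 1) d.O.proj (d.O.toFun x₀ t₀) w with hv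
  have hwL : w = L (ContinuousLinearMap.inl ℝ (TangentSpace (𝓡 1) x₀)
      (TangentSpace 𝓘(ℝ, ℝ) t₀) v) := by
    have h := d.apply_prod_apply_eq x₀ ht₀' hL w
    rw [ht0] at h
    exact h.symm
  have key : (mfderiv (𝓡∂ 2) 𝓘(ℝ, 𝔼 4) d.formula (d.O.toFun x₀ t₀)) w =
      m • (mfderiv (𝓡∂ 2) 𝓘(ℝ, 𝔼 4) d.F (d.O.toFun x₀ (frz t₀)))
        (L₁ (ContinuousLinearMap.inl ℝ (TangentSpace (𝓡 1) x₀)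
          (TangentSpace 𝓘(ℝ, ℝ) (frz t₀)) v)) := by
    have e := DFunLike.congr_fun (h1.symm.trans h2) v
    rw [hwL]
    exact e
  rw [hw] at key
  have h3 : (mfderiv (𝓡∂ 2) 𝓘(ℝ, 𝔼 4) d.F (d.O.toFun x₀ (frz t₀)))
      (L₁ (ContinuousLinearMap.inl ℝ (TangentSpace (𝓡 1) x₀)
        (TangentSpace 𝓘(ℝ, ℝ) (frz t₀)) v)) = 0 :=
    ((smul_eq_zero_iff_right hm).1 key.symm)
  have h4 := (injective_iff_map_eq_zero _).1 (d.imm _) _ h3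
  have h5 := (injective_iff_map_eq_zero _).1 hInv2 _ h4
  have h6 : v = 0 := congrArg Prod.fst h5
  rw [hwL, h6]
  have h7 : (ContinuousLinearMap.inl ℝ (TangentSpace (𝓡 1) x₀) (TangentSpace 𝓘(ℝ, ℝ) t₀)) 0 = 0 :=
    map_zero _
  rw [h7]
  exact map_zero L

/-- **The frozen map is an immersion.** [folklore] -/
theorem injective_mfderiv_newMap (z : S) :
    Injective (mfderiv (𝓡∂ 2) 𝓘(ℝ, 𝔼 4) d.newMap z) := by
  rcases lt_or_ge (d.tfun z) (3 / 2) with hz | hz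
  · have hev : d.newMap =ᶠ[𝓝 z] d.formula := by
      filter_upwards [d.isOpen_zone.mem_nhds hz] with q hq using d.newMap_of_tfun_lt hq
    rw [hev.mfderiv_eq]
    have hzeq : d.O.toFun (d.O.proj z) (d.tfun z) = z := d.toFun_proj_tfun (d.zone_subset_region hz)
    rw [← hzeq]
    exact d.injective_mfderiv_formula (d.O.proj z) ⟨d.tfun_nonneg z, hz⟩
  · have hz1 : 1 < d.tfun z := by linarith
    have hev : d.newMap =ᶠ[𝓝 z] d.F := by
      filter_upwards [d.isOpen_far.mem_nhds hz1] with q hq using d.newMap_of_one_le (le_of_lt hq)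
    rw [hev.mfderiv_eq]
    exact d.imm z

end NeatData

end NeatStraightening

/-! ## Straightening a neat slice surface -/

/-- **A neat slice surface of genus `g` can be made radial near its boundary** — the neat case of
fact A (`Literature.Topology.FourManifolds.Knot.HasSliceSurfaceOfGenus.exists_radial`) of `SliceGenusConcordance.lean`, with
the conclusion spelled out (the abstract surface `S` and the boundary identification `e` are kept;
the map is the frozen map of `NeatData`, equal to `F` off the collar zone and to the cone
`‖F z‖ • K (e (proj z))` on the collar band `t ≤ 1/2`; the width of the radial band is `a/8`).
Kosinski (1993), II (2.8.2): a neat submanifold is vertical in a suitable collar of the boundary;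
here the collar of `∂S` is the flow-out along the levels of `‖F‖` (`BoundaryFlowout.lean`).
[cite: Kosinski1993, II (2.8.2)] -/
theorem HasNeatSliceSurfaceOfGenus.exists_radial {K : Knot} {g : ℕ}
    (h : K.HasNeatSliceSurfaceOfGenus g) :
    ∃ (S : Type) (_ : TopologicalSpace S) (_ : T2Space S) (_ : SecondCountableTopology S)
      (_ : CompactSpace S) (_ : ConnectedSpace S) (_ : ChartedSpace (EuclideanHalfSpace 2) S)
      (_ : IsManifold (𝓡∂ 2) ∞ S) (F : S → 𝔼 4) (e : ↥((𝓡∂ 2).boundary S) ≃ₜ ↥(𝕊 1)),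
      K.IsSpanningSurfaceOfGenus F e g ∧ (∀ x ∈ (𝓡∂ 2).interior S, ‖F x‖ < 1) ∧
      ∃ (δ : ℝ) (π : S → 𝕊 1), 0 < δ ∧
        ContMDiffOn (𝓡∂ 2) (𝓡 1) ∞ π {p | 1 - δ < ‖F p‖} ∧
        ∀ p, 1 - δ < ‖F p‖ → F p = ‖F p‖ • ((K (π p) : 𝕊 3) : 𝔼 4) := by
  obtain ⟨S, i₁, i₂, i₃, i₄, i₅, i₆, i₇, F, e, ⟨hor, hFs, hFi, hFimm, hFb, hrank⟩, hint, hneat⟩ := h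
  obtain ⟨D, Γ, hD⟩ := NeatStraightening.exists_cover hFs hFb hint hneat
  haveI : Nonempty (NeatStraightening.bdry S).carrier := ⟨e.symm (circlePoint 0)⟩
  let d : NeatStraightening.NeatData S K :=
    { F := F, e := e, smooth := hFs, inj := hFi, imm := hFimm, bdryEq := hFb, interior_lt := hint,
      D := D, Γ := Γ, f_eq := hD }
  refine ⟨S, i₁, i₂, i₃, i₄, i₅, i₆, i₇, d.newMap, e,
    ⟨hor, d.contMDiff_newMap, d.injective_newMap, d.injective_mfderiv_newMap, d.newMap_coe, hrank⟩,
    fun x hx ↦ d.norm_newMap_lt hx, d.δ₀, d.ang, d.δ₀_pos,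
    d.contMDiffOn_ang.mono d.band_subset_region, fun p hp ↦ d.newMap_eq_smul_of_band hp⟩

end Knot

end Literature.Topology.FourManifolds
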